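import Summits.ResolutionOfSingularities.ResolutionOfSingularities.Theorems.FrobeniusLadderFInjectiveMacaulayficationCertifiedCoverCongr
import Summits.ResolutionOfSingularities.ResolutionOfSingularities.Theorems.FrobeniusLadderFInjectiveMacaulayficationCertificatesLocalization
import Mathlib.AlgebraicGeometry.AffineScheme
import HarnessLib
/-!
# The certified-chart class at a point carrying an AWAY-CHART of a certified ring
# (crux `FInjectiveMacaulayfication`, T-𝒫 programme §4b — engine-agnostic half)

[OURS · L1 W4.5a · res-L1-w45a-stub-3] Support file (`--supports stmt-ResolutionOfSingularities-15315 --as helper`) for the crux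
`FrobeniusLadder.FInjectiveMacaulayfication`; NOT a statement of any manuscript; AI-written, weaker than expert review.

`L/w45a/ClassGlueSig.lean` v2 sha16 239444958d057f2d (§1–§4 byte-identical in v3 74b6a04e74c75940) §4b asks for `P_cert X₁ f₁ b`
— the certified-chart class of §2, an «∀ W ∋ b, ∃ affine U ⊆ W …» statement — at every bad point `b` that carries an affine open
`U ∋ b` whose ring is an AWAY-LOCALISATION `R[1/h]` of a CERTIFIED ring `R` (E6‴ certificate block for an ideal `I` with
`V(I) = V(𝔪)`, `𝔪` the contraction of the prime of `b`). This file proves that engine-agnostic step (rulings R10.4 / R11.1):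

* `cert_isLocalizationAway` — the certificate block passes from `R` to ANY `R`-algebra `S` with `IsLocalization.Away s S`, `s ≠ 0`
  (stub-5's ring-level `CertificatesLocalization.certificatesLocalization` = §3a, moved along `IsLocalization.algEquiv` by
  `CertifiedCoverCongr.cert_congr`, p507617);
* `primeIdealOf_le_iff_eq` — on an affine open, `𝔭_b ≤ 𝔭_x ↔ x = b` for a closed point `b` (specialisation);
  `comap_primeIdealOf_basicOpen` — the prime of a point of `D(s) ⊆ U` contracts to its prime in `U`;
* `certifiedChart_of_awayChart` — **`P_cert` at `b`** from: `b` closed, alone-F-bad inside some open `V₀`, an affine `U ∋ b` with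
  `Γ(X₁, U)` an `IsLocalization.Away h` `R`-algebra (`h ≠ 0`), `𝔭_b ∩ R = 𝔪`, `I ≠ 0` with «`I ≤ P ↔ 𝔪 ≤ P`» on primes, and the
  certificate block on `R`. Proof: given `W ∋ b`, shrink to a basic open `D(s) ⊆ W ∩ V₀` of `U` around `b`
  (`IsAffineOpen.exists_basicOpen_le`); `Γ(X₁, D(s))` is `IsLocalization.Away s` over `Γ(X₁, U)`
  (`IsAffineOpen.isLocalization_basicOpen`); move the block `R → Γ(X₁, U) → Γ(X₁, D(s))` by `cert_isLocalizationAway` twice; the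
  zero locus of the extended ideal in `D(s)` is `{b}` because ideals of a localisation are ordered like their contractions
  (`IsLocalization.under_le_under_iff`) and `𝔭_b ≤ 𝔭_x ↔ b ⤳ x ↔ x = b`;
* `certifiedChart_of_awayChartEquiv` — the same from an explicit `ε : Γ(X₁, U) ≃+* R[1/h]`.

The door corollaries (§4b proper: CN / graded / filtered chart models) are in `FInjectiveMacaulayficationOfChartModels`.
-/

-- single-problem summit: the doubled namespace component is forced
set_option linter.dupNamespace false

noncomputable section

namespace Summit.ResolutionOfSingularities.ResolutionOfSingularities.Theorems.FInjectiveMacaulayfication.CertifiedChartOfAwayChart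

open AlgebraicGeometry CategoryTheory Literature.AlgebraicGeometry.Resolution TopologicalSpace
open Summit.ResolutionOfSingularities.ResolutionOfSingularities.Theorems.FInjectiveMacaulayfication

/-! ## §1 Certificates along `IsLocalization.Away` algebras -/

/-- **The certificate block passes to any away-localisation algebra** `S` of `R` at `s ≠ 0` (extended ideal
`I·S`): §3a for the model `R[1/s]`, moved along `R[1/s] ≃ₐ[R] S` (`IsLocalization.algEquiv`) by
`CertifiedCoverCongr.cert_congr`. [folklore] -/
theorem cert_isLocalizationAway (p : ℕ) [Fact p.Prime] (R S : Type) [CommRing R] [IsDomain R] [IsNoetherianRing R]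
    [CharP R p] [CommRing S] [Algebra R S] (s : R) (hs : s ≠ 0) [IsLocalization.Away s S] (I : Ideal R)
    (h : ∃ (t : ℕ) (v : Fin t → R) (hv : ∀ j : Fin t, v j ∈ I),
        (HomogeneousIdeal.irrelevant (reesGrading (I))).toIdeal ≤ (Ideal.span (Set.range fun j : Fin t => reesT (I := I) (v j) (hv j))).radical ∧
        (∀ j : Fin t, v j ≠ 0) ∧
        ∀ (j : Fin t) (Q : Ideal (Literature.AlgebraicGeometry.Resolution.blowupAlgebra (I) (v j))) [Q.IsMaximal],
          algebraMap R (Literature.AlgebraicGeometry.Resolution.blowupAlgebra (I) (v j)) (v j) ∈ Q →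
          ∀ d : ℕ, ringKrullDim (Localization.AtPrime Q) = d → ∀ s : Fin d → Localization.AtPrime Q, (Ideal.span (Set.range s)).radical.IsMaximal → RingTheory.Sequence.IsWeaklyRegular (Localization.AtPrime Q) (List.ofFn s) ∧ ∀ y : Localization.AtPrime Q, (∃ e : ℕ, y ^ p ^ e ∈ Ideal.span ((fun z : Localization.AtPrime Q => z ^ p ^ e) '' (Ideal.span (Set.range s) : Set (Localization.AtPrime Q)))) → y ∈ Ideal.span (Set.range s)) :
    ∃ (t : ℕ) (v : Fin t → S) (hv : ∀ j : Fin t, v j ∈ Ideal.map (algebraMap R S) I),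
      (HomogeneousIdeal.irrelevant (reesGrading (Ideal.map (algebraMap R S) I))).toIdeal ≤ (Ideal.span (Set.range fun j : Fin t => reesT (I := Ideal.map (algebraMap R S) I) (v j) (hv j))).radical ∧
      (∀ j : Fin t, v j ≠ 0) ∧
      ∀ (j : Fin t) (Q : Ideal (Literature.AlgebraicGeometry.Resolution.blowupAlgebra (Ideal.map (algebraMap R S) I) (v j))) [Q.IsMaximal],
        algebraMap S (Literature.AlgebraicGeometry.Resolution.blowupAlgebra (Ideal.map (algebraMap R S) I) (v j)) (v j) ∈ Q →
        ∀ d : ℕ, ringKrullDim (Localization.AtPrime Q) = d → ∀ s : Fin d → Localization.AtPrime Q, (Ideal.span (Set.range s)).radical.IsMaximal → RingTheory.Sequence.IsWeaklyRegular (Localization.AtPrime Q) (List.ofFn s) ∧ ∀ y : Localization.AtPrime Q, (∃ e : ℕ, y ^ p ^ e ∈ Ideal.span ((fun z : Localization.AtPrime Q => z ^ p ^ e) '' (Ideal.span (Set.range s) : Set (Localization.AtPrime Q)))) → y ∈ Ideal.span (Set.range s) := by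
  obtain ⟨t, v, hv, hcov, hv0, hon⟩ := h
  obtain ⟨hcov', hv0', hon'⟩ := CertificatesLocalization.certificatesLocalization p R I t v hv ⟨hcov, hv0, hon⟩ s hs
  have key := CertifiedCoverCongr.cert_congr p
    (IsLocalization.algEquiv (Submonoid.powers s) (Localization.Away s) S).toRingEquiv
    (Ideal.map (algebraMap R (Localization.Away s)) I) ⟨t, _, _, hcov', hv0', hon'⟩
  have hcomp : ((IsLocalization.algEquiv (Submonoid.powers s) (Localization.Away s) S).toRingEquiv : Localization.Away s →+* S).comp
      (algebraMap R (Localization.Away s)) = algebraMap R S :=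
    (IsLocalization.algEquiv (Submonoid.powers s) (Localization.Away s) S).toAlgHom.comp_algebraMap
  have hEq : Ideal.map (IsLocalization.algEquiv (Submonoid.powers s) (Localization.Away s) S).toRingEquiv
      (Ideal.map (algebraMap R (Localization.Away s)) I) = Ideal.map (algebraMap R S) I := by
    rw [← hcomp, ← Ideal.map_map]
    rfl
  exact hEq ▸ key

/-! ## §2 Closed points on an affine open -/

/-- On an affine open `U`, for a CLOSED point `b ∈ U` and any `x ∈ U`: `𝔭_b ≤ 𝔭_x ↔ x = b` (ideal order on `Spec Γ(X, U)` is
specialisation, `U.fromSpec` is an embedding, and the closure of `{b}` is `{b}`). [folklore] -/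
theorem primeIdealOf_le_iff_eq {X : Scheme.{0}} (U : X.affineOpens) {b x : X} (hb : IsClosed ({b} : Set X))
    (hbU : b ∈ (U : X.Opens)) (hxU : x ∈ (U : X.Opens)) :
    (U.2.primeIdealOf ⟨b, hbU⟩).asIdeal ≤ (U.2.primeIdealOf ⟨x, hxU⟩).asIdeal ↔ x = b := by
  change U.2.primeIdealOf ⟨b, hbU⟩ ≤ U.2.primeIdealOf ⟨x, hxU⟩ ↔ _
  constructor
  · intro hle
    have hsp := ((PrimeSpectrum.le_iff_specializes _ _).mp hle).map U.2.fromSpec.continuous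
    rw [U.2.fromSpec_primeIdealOf ⟨b, hbU⟩, U.2.fromSpec_primeIdealOf ⟨x, hxU⟩,
      specializes_iff_mem_closure, hb.closure_eq, Set.mem_singleton_iff] at hsp
    exact hsp
  · rintro rfl
    exact le_rfl

/-- The prime of a point of a basic open `D(s) ⊆ U` contracts to its prime in `U`. [folklore] -/
theorem comap_primeIdealOf_basicOpen {X : Scheme.{0}} (U : X.affineOpens) (s : Γ(X, U)) {x : X}
    (hx : x ∈ X.basicOpen s) :
    ((U.2.basicOpen s).primeIdealOf ⟨x, hx⟩).asIdeal.comap (algebraMap Γ(X, U) Γ(X, X.basicOpen s)) =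
      (U.2.primeIdealOf ⟨x, X.basicOpen_le s hx⟩).asIdeal := by
  have h := IsAffineOpen.comap_primeIdealOf_appLE (f := 𝟙 X) (x := x) (U : X.Opens) U.2 (X.basicOpen s)
    (U.2.basicOpen s) (by simpa using X.basicOpen_le s) hx
  have happ : ((𝟙 X : X ⟶ X).appLE (U : X.Opens) (X.basicOpen s) (by simpa using X.basicOpen_le s)).hom =
      algebraMap Γ(X, U) Γ(X, X.basicOpen s) := by
    rw [Scheme.Hom.appLE, Scheme.Hom.id_app, CommRingCat.hom_comp]
    exact RingHom.ext fun _ => rfl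
  rw [← happ]
  exact congrArg PrimeSpectrum.asIdeal h

/-! ## §3 `P_cert` from an away-chart -/

/-- **THE CERTIFIED-CHART CLASS AT A POINT WITH A CERTIFIED AWAY-CHART.** `X₁` integral; `b` a closed point, the only F-bad point
of some open `V₀`; `U ∋ b` an affine open whose ring `Γ(X₁, U)` is an `IsLocalization.Away h` algebra (`h ≠ 0`) over a
Noetherian domain `R` of characteristic `p`; `𝔭_b ∩ R = 𝔪`; an ideal `I ≠ 0` of `R` with `V(I) = V(𝔪)` («`I ≤ P ↔ 𝔪 ≤ P`» for
primes `P`) carrying the E6‴ certificate block. Then `b` is in the certified-chart class `P_cert` (`ClassGlueSig` v2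
239444958d057f2d §2, text verbatim): inside every open `W ∋ b` the basic open `D(s) ⊆ W ∩ V₀` of `U` around `b` is a certified
affine chart, with the block moved `R → Γ(X₁, U) → Γ(X₁, D(s))` (`cert_isLocalizationAway` twice). [folklore] -/
theorem certifiedChart_of_awayChart (p : ℕ) [Fact p.Prime] (X₁ : Scheme.{0}) [IsIntegral X₁]
    (b : X₁) (hb : IsClosed ({b} : Set X₁))
    (V₀ : X₁.Opens) (hbV₀ : b ∈ V₀) (hV₀ : ∀ x : X₁, x ∈ V₀ → x ≠ b → ∀ d : ℕ, ringKrullDim (X₁.presheaf.stalk x) = d → ∀ s : Fin d → X₁.presheaf.stalk x, (Ideal.span (Set.range s)).radical.IsMaximal → ∀ y : X₁.presheaf.stalk x, (∃ e : ℕ, y ^ p ^ e ∈ Ideal.span ((fun z : X₁.presheaf.stalk x => z ^ p ^ e) '' (Ideal.span (Set.range s) : Set (X₁.presheaf.stalk x)))) → y ∈ Ideal.span (Set.range s))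
    (U : X₁.affineOpens) (hbU : b ∈ (U : X₁.Opens))
    (R : Type) [CommRing R] [IsDomain R] [IsNoetherianRing R] [CharP R p] [Algebra R Γ(X₁, U)]
    (h : R) (hh : h ≠ 0) [IsLocalization.Away h Γ(X₁, U)]
    (I 𝔪 : Ideal R) (hI : I ≠ ⊥) (hzero : ∀ P : Ideal R, P.IsPrime → (I ≤ P ↔ 𝔪 ≤ P))
    (hbm : (U.2.primeIdealOf ⟨b, hbU⟩).asIdeal.comap (algebraMap R Γ(X₁, U)) = 𝔪)
    (hcert : ∃ (t : ℕ) (v : Fin t → R) (hv : ∀ j : Fin t, v j ∈ I),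
        (HomogeneousIdeal.irrelevant (reesGrading (I))).toIdeal ≤ (Ideal.span (Set.range fun j : Fin t => reesT (I := I) (v j) (hv j))).radical ∧
        (∀ j : Fin t, v j ≠ 0) ∧
        ∀ (j : Fin t) (Q : Ideal (Literature.AlgebraicGeometry.Resolution.blowupAlgebra (I) (v j))) [Q.IsMaximal],
          algebraMap R (Literature.AlgebraicGeometry.Resolution.blowupAlgebra (I) (v j)) (v j) ∈ Q →
          ∀ d : ℕ, ringKrullDim (Localization.AtPrime Q) = d → ∀ s : Fin d → Localization.AtPrime Q, (Ideal.span (Set.range s)).radical.IsMaximal → RingTheory.Sequence.IsWeaklyRegular (Localization.AtPrime Q) (List.ofFn s) ∧ ∀ y : Localization.AtPrime Q, (∃ e : ℕ, y ^ p ^ e ∈ Ideal.span ((fun z : Localization.AtPrime Q => z ^ p ^ e) '' (Ideal.span (Set.range s) : Set (Localization.AtPrime Q)))) → y ∈ Ideal.span (Set.range s)) :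
    ∀ W : X₁.Opens, b ∈ W → ∃ U : X₁.affineOpens, (U : X₁.Opens) ≤ W ∧ b ∈ (U : X₁.Opens) ∧
      (∀ x : X₁, x ∈ (U : X₁.Opens) → x ≠ b → ∀ d : ℕ, ringKrullDim (X₁.presheaf.stalk x) = d → ∀ s : Fin d → X₁.presheaf.stalk x, (Ideal.span (Set.range s)).radical.IsMaximal → ∀ y : X₁.presheaf.stalk x, (∃ e : ℕ, y ^ p ^ e ∈ Ideal.span ((fun z : X₁.presheaf.stalk x => z ^ p ^ e) '' (Ideal.span (Set.range s) : Set (X₁.presheaf.stalk x)))) → y ∈ Ideal.span (Set.range s)) ∧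
      CharP Γ(X₁, U) p ∧ ∃ (I : Ideal Γ(X₁, U)), I ≠ ⊥ ∧
      (∀ (x : X₁) (hx : x ∈ (U : X₁.Opens)), I ≤ (U.2.primeIdealOf ⟨x, hx⟩).asIdeal ↔ x = b) ∧
      ∃ (t : ℕ) (v : Fin t → Γ(X₁, U)) (hv : ∀ j : Fin t, v j ∈ I),
        (HomogeneousIdeal.irrelevant (reesGrading I)).toIdeal ≤ (Ideal.span (Set.range fun j : Fin t => reesT (I := I) (v j) (hv j))).radical ∧
        (∀ j : Fin t, v j ≠ 0) ∧
        ∀ (j : Fin t) (Q : Ideal (Literature.AlgebraicGeometry.Resolution.blowupAlgebra I (v j))) [Q.IsMaximal],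
          algebraMap Γ(X₁, U) (Literature.AlgebraicGeometry.Resolution.blowupAlgebra I (v j)) (v j) ∈ Q →
          ∀ d : ℕ, ringKrullDim (Localization.AtPrime Q) = d → ∀ s : Fin d → Localization.AtPrime Q, (Ideal.span (Set.range s)).radical.IsMaximal → RingTheory.Sequence.IsWeaklyRegular (Localization.AtPrime Q) (List.ofFn s) ∧ ∀ y : Localization.AtPrime Q, (∃ e : ℕ, y ^ p ^ e ∈ Ideal.span ((fun z : Localization.AtPrime Q => z ^ p ^ e) '' (Ideal.span (Set.range s) : Set (Localization.AtPrime Q)))) → y ∈ Ideal.span (Set.range s) := by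
  intro W hbW
  -- the chart ring is a Noetherian domain of characteristic `p`
  haveI : Nonempty (U : X₁.Opens) := ⟨⟨b, hbU⟩⟩
  haveI : IsDomain Γ(X₁, U) := IsIntegral.component_integral (U : X₁.Opens)
  haveI : IsNoetherianRing Γ(X₁, U) := IsLocalization.isNoetherianRing (Submonoid.powers h) Γ(X₁, U) inferInstance
  have hinjR : Function.Injective (algebraMap R Γ(X₁, U)) :=
    IsLocalization.injective Γ(X₁, U) (powers_le_nonZeroDivisors_of_noZeroDivisors hh)
  haveI : CharP Γ(X₁, U) p := charP_of_injective_ringHom hinjR p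
  -- (1) shrink to a basic open `D(s) ⊆ W ∩ V₀` of `U` around `b`
  obtain ⟨s, hsW, hbs⟩ := U.2.exists_basicOpen_le (V := W ⊓ V₀) ⟨b, ⟨hbW, hbV₀⟩⟩ hbU
  have hs0 : s ≠ 0 := by
    rintro rfl
    rw [Scheme.basicOpen_zero] at hbs
    exact hbs
  haveI : IsLocalization.Away s Γ(X₁, X₁.basicOpen s) := U.2.isLocalization_basicOpen s
  have hinjU : Function.Injective (algebraMap Γ(X₁, U) Γ(X₁, X₁.basicOpen s)) :=
    IsLocalization.injective Γ(X₁, X₁.basicOpen s) (powers_le_nonZeroDivisors_of_noZeroDivisors hs0)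
  -- (2) move the certificate block `R → Γ(X₁, U) → Γ(X₁, D(s))`
  have hcertU := cert_isLocalizationAway p R Γ(X₁, U) h hh I hcert
  have hcertD := cert_isLocalizationAway p Γ(X₁, U) Γ(X₁, X₁.basicOpen s) s hs0
    (Ideal.map (algebraMap R Γ(X₁, U)) I) hcertU
  refine ⟨⟨X₁.basicOpen s, U.2.basicOpen s⟩, fun x hx => (hsW hx).1, hbs,
    fun x hx hxb => hV₀ x (hsW hx).2 hxb, charP_of_injective_ringHom hinjU p,
    Ideal.map (algebraMap Γ(X₁, U) Γ(X₁, X₁.basicOpen s)) (Ideal.map (algebraMap R Γ(X₁, U)) I), ?_, ?_, hcertD⟩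
  · -- `I·Γ(X₁, D(s)) ≠ 0`
    intro h0
    rw [Ideal.map_eq_bot_iff_of_injective hinjU, Ideal.map_eq_bot_iff_of_injective hinjR] at h0
    exact hI h0
  · -- zero locus `{b}`
    intro x hx
    have hxU : x ∈ (U : X₁.Opens) := X₁.basicOpen_le s hx
    haveI := ((U.2.basicOpen s).primeIdealOf ⟨x, hx⟩).isPrime
    rw [Ideal.map_le_iff_le_comap, Ideal.map_le_iff_le_comap, comap_primeIdealOf_basicOpen U s hx,
      hzero _ (Ideal.comap_isPrime _ _), ← hbm]
    change ((U.2.primeIdealOf ⟨b, hbU⟩).asIdeal.under R ≤ (U.2.primeIdealOf ⟨x, hxU⟩).asIdeal.under R) ↔ _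
    rw [IsLocalization.under_le_under_iff (Submonoid.powers h) Γ(X₁, U)]
    exact primeIdealOf_le_iff_eq U hb hbU hxU

/-- **`P_cert` from a certified away-chart given by an explicit ring isomorphism** `ε : Γ(X₁, U) ≃+* R[1/h]` under which the
prime of `b` pulls back to `𝔪 ⊆ R` (the user-facing form of `certifiedChart_of_awayChart`: `Γ(X₁, U)` becomes an
`IsLocalization.Away h` algebra over `R` through `ε`, `IsLocalization.isLocalization_of_algEquiv`). [folklore] -/
theorem certifiedChart_of_awayChartEquiv (p : ℕ) [Fact p.Prime] (X₁ : Scheme.{0}) [IsIntegral X₁]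
    (b : X₁) (hb : IsClosed ({b} : Set X₁))
    (V₀ : X₁.Opens) (hbV₀ : b ∈ V₀) (hV₀ : ∀ x : X₁, x ∈ V₀ → x ≠ b → ∀ d : ℕ, ringKrullDim (X₁.presheaf.stalk x) = d → ∀ s : Fin d → X₁.presheaf.stalk x, (Ideal.span (Set.range s)).radical.IsMaximal → ∀ y : X₁.presheaf.stalk x, (∃ e : ℕ, y ^ p ^ e ∈ Ideal.span ((fun z : X₁.presheaf.stalk x => z ^ p ^ e) '' (Ideal.span (Set.range s) : Set (X₁.presheaf.stalk x)))) → y ∈ Ideal.span (Set.range s))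
    (U : X₁.affineOpens) (hbU : b ∈ (U : X₁.Opens))
    (R : Type) [CommRing R] [IsDomain R] [IsNoetherianRing R] [CharP R p] (I 𝔪 : Ideal R) (h : R) (hh : h ≠ 0)
    (ε : Γ(X₁, U) ≃+* Localization.Away h)
    (hI : I ≠ ⊥) (hzero : ∀ P : Ideal R, P.IsPrime → (I ≤ P ↔ 𝔪 ≤ P))
    (hbm : Ideal.comap ((ε.symm : Localization.Away h →+* Γ(X₁, U)).comp (algebraMap R (Localization.Away h)))
      (U.2.primeIdealOf ⟨b, hbU⟩).asIdeal = 𝔪)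
    (hcert : ∃ (t : ℕ) (v : Fin t → R) (hv : ∀ j : Fin t, v j ∈ I),
        (HomogeneousIdeal.irrelevant (reesGrading (I))).toIdeal ≤ (Ideal.span (Set.range fun j : Fin t => reesT (I := I) (v j) (hv j))).radical ∧
        (∀ j : Fin t, v j ≠ 0) ∧
        ∀ (j : Fin t) (Q : Ideal (Literature.AlgebraicGeometry.Resolution.blowupAlgebra (I) (v j))) [Q.IsMaximal],
          algebraMap R (Literature.AlgebraicGeometry.Resolution.blowupAlgebra (I) (v j)) (v j) ∈ Q →
          ∀ d : ℕ, ringKrullDim (Localization.AtPrime Q) = d → ∀ s : Fin d → Localization.AtPrime Q, (Ideal.span (Set.range s)).radical.IsMaximal → RingTheory.Sequence.IsWeaklyRegular (Localization.AtPrime Q) (List.ofFn s) ∧ ∀ y : Localization.AtPrime Q, (∃ e : ℕ, y ^ p ^ e ∈ Ideal.span ((fun z : Localization.AtPrime Q => z ^ p ^ e) '' (Ideal.span (Set.range s) : Set (Localization.AtPrime Q)))) → y ∈ Ideal.span (Set.range s)) :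
    ∀ W : X₁.Opens, b ∈ W → ∃ U : X₁.affineOpens, (U : X₁.Opens) ≤ W ∧ b ∈ (U : X₁.Opens) ∧
      (∀ x : X₁, x ∈ (U : X₁.Opens) → x ≠ b → ∀ d : ℕ, ringKrullDim (X₁.presheaf.stalk x) = d → ∀ s : Fin d → X₁.presheaf.stalk x, (Ideal.span (Set.range s)).radical.IsMaximal → ∀ y : X₁.presheaf.stalk x, (∃ e : ℕ, y ^ p ^ e ∈ Ideal.span ((fun z : X₁.presheaf.stalk x => z ^ p ^ e) '' (Ideal.span (Set.range s) : Set (X₁.presheaf.stalk x)))) → y ∈ Ideal.span (Set.range s)) ∧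
      CharP Γ(X₁, U) p ∧ ∃ (I : Ideal Γ(X₁, U)), I ≠ ⊥ ∧
      (∀ (x : X₁) (hx : x ∈ (U : X₁.Opens)), I ≤ (U.2.primeIdealOf ⟨x, hx⟩).asIdeal ↔ x = b) ∧
      ∃ (t : ℕ) (v : Fin t → Γ(X₁, U)) (hv : ∀ j : Fin t, v j ∈ I),
        (HomogeneousIdeal.irrelevant (reesGrading I)).toIdeal ≤ (Ideal.span (Set.range fun j : Fin t => reesT (I := I) (v j) (hv j))).radical ∧
        (∀ j : Fin t, v j ≠ 0) ∧
        ∀ (j : Fin t) (Q : Ideal (Literature.AlgebraicGeometry.Resolution.blowupAlgebra I (v j))) [Q.IsMaximal],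
          algebraMap Γ(X₁, U) (Literature.AlgebraicGeometry.Resolution.blowupAlgebra I (v j)) (v j) ∈ Q →
          ∀ d : ℕ, ringKrullDim (Localization.AtPrime Q) = d → ∀ s : Fin d → Localization.AtPrime Q, (Ideal.span (Set.range s)).radical.IsMaximal → RingTheory.Sequence.IsWeaklyRegular (Localization.AtPrime Q) (List.ofFn s) ∧ ∀ y : Localization.AtPrime Q, (∃ e : ℕ, y ^ p ^ e ∈ Ideal.span ((fun z : Localization.AtPrime Q => z ^ p ^ e) '' (Ideal.span (Set.range s) : Set (Localization.AtPrime Q)))) → y ∈ Ideal.span (Set.range s) := by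
  -- `Γ(X₁, U)` as an `IsLocalization.Away h` algebra over `R` through `ε`
  letI : Algebra R Γ(X₁, U) :=
    ((ε.symm : Localization.Away h →+* Γ(X₁, U)).comp (algebraMap R (Localization.Away h))).toAlgebra
  let e : Localization.Away h ≃ₐ[R] Γ(X₁, U) := { ε.symm with commutes' := fun r => rfl }
  haveI : IsLocalization.Away h Γ(X₁, U) := IsLocalization.isLocalization_of_algEquiv (Submonoid.powers h) e
  exact certifiedChart_of_awayChart p X₁ b hb V₀ hbV₀ hV₀ U hbU R h hh I 𝔪 hI hzero hbm hcert

end Summit.ResolutionOfSingularities.ResolutionOfSingularities.Theorems.FInjectiveMacaulayfication.CertifiedChartOfAwayChart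

end
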